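import Summits.FinalStateConjecture.FinalStateConjecture.Theorems.UniformPhotonSphereChannels.Negative.VolterraSmooth
import Summits.FinalStateConjecture.FinalStateConjecture.Theorems.PhotonSphereChannelsBlindnessWaveSolution

/-!
# Crux `UniformPhotonSphereChannels` (K1), negative side — global even `C³` solutions

Support file of the standing disprover of item stmt-FinalStateConjecture-10045.  One more round of
the bootstrap of `PhotonSphereChannelsBlindnessWaveRegularity`: if the coefficient `c` is `C²` and
the datum `A` is `C³`, the solution `Ψ` of the characteristic Volterra pair is `C³`
(`contDiff_three_psi`: `Ψ_a = A'/2·… − ∫ cΨ`, `Ψ_b = Q = A'/2 + ∫ cΨ` are `C²` by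
`contDiff_volterra_fst/snd`), and hence the even solution of `ψ_tt − ψ_xx + Vψ = 0` with compactly
supported `C³` data produced by `Blindness.exists_even_solution` is `C³` for `V ∈ C²`
(`exists_even_solution_C3`, same proof with the upgraded regularity).  The rest-packet pinning of
the refutation commutes the equation with `∂ₓ` and therefore needs this third derivative.
[folklore]
-/

noncomputable section

open Set Filter MeasureTheory intervalIntegral Topology Function

namespace Summit.FinalStateConjecture.FinalStateConjecture.Theorems.Blindness

section Bootstrap

variable {c Ψ Q : ℝ → ℝ → ℝ} {A : ℝ → ℝ}

/-- **Third bootstrap round: the solution of the characteristic integral equations is `C³`**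
when `c ∈ C²` and `A ∈ C³`. -/
theorem contDiff_three_psi (hc : ContDiff ℝ 2 (uncurry c)) (hA : ContDiff ℝ 3 A)
    (hΨc : Continuous (uncurry Ψ)) (hQc : Continuous (uncurry Q))
    (hΨ : ∀ a b, Ψ a b = A a - ∫ s in b..a, Q a s)
    (hQ : ∀ a b, Q a b = deriv A b / 2 + ∫ s in b..a, c s b * Ψ s b) :
    ContDiff ℝ 3 (uncurry Ψ) := by
  have hc1 : ContDiff ℝ 1 (uncurry c) := hc.of_le (by norm_num)
  have hA2 : ContDiff ℝ 2 A := hA.of_le (by norm_num)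
  have hcc : Continuous (uncurry c) := hc.continuous
  have hΨ2 : ContDiff ℝ 2 (uncurry Ψ) := contDiff_two_psi hc1 hA2 hΨc hQc hΨ hQ
  have hA' : ContDiff ℝ 2 (deriv A) := (contDiff_succ_iff_deriv.mp hA).2.2
  -- the `C²` kernels
  have hk : ContDiff ℝ 2 (uncurry fun s b => c s b * Ψ s b) := hc.mul hΨ2
  have hk' : ContDiff ℝ 2 (uncurry fun a s => c a s * Ψ a s) := hc.mul hΨ2
  -- `Q ∈ C²`
  have hQ2 : ContDiff ℝ 2 (uncurry Q) := by
    have heq : uncurry Q = fun p : ℝ × ℝ => deriv A p.2 / 2 + ∫ s in p.2..p.1, c s p.2 * Ψ s p.2 := by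
      funext p; exact hQ p.1 p.2
    rw [heq]
    exact ((hA'.comp contDiff_snd).div_const 2).add (contDiff_volterra_snd 1 hk)
  -- `P ∈ C²`
  have hP2 : ContDiff ℝ 2 (fun p : ℝ × ℝ =>
      deriv A p.1 - Q p.1 p.1 - ∫ s in p.2..p.1, c p.1 s * Ψ p.1 s) := by
    refine ((hA'.comp contDiff_fst).sub ?_).sub (contDiff_volterra_fst 1 hk')
    exact hQ2.comp (contDiff_fst.prodMk contDiff_fst)
  have h := Literature.Analysis.Calculus.contDiffOn_succ_of_partial (f := uncurry Ψ)
    (U := univ) isOpen_univ (n := 2)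
    (f₁ := fun p : ℝ × ℝ =>
      (deriv A p.1 - Q p.1 p.1 - ∫ s in p.2..p.1, c p.1 s * Ψ p.1 s) • (1 : ℝ →L[ℝ] ℝ))
    (f₂ := fun p : ℝ × ℝ => (Q p.1 p.2) • (1 : ℝ →L[ℝ] ℝ))
    (fun p _ => hasFDerivAt_smul_one_of_hasDerivAt (hasDerivAt_psi_fst hcc hA2 hΨc hQc hΨ hQ p.1 p.2))
    (fun p _ => hasFDerivAt_smul_one_of_hasDerivAt (hasDerivAt_psi_snd hQc hΨ p.1 p.2))
    ((hP2.smul contDiff_const).contDiffOn)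
    ((hQ2.smul contDiff_const).contDiffOn)
  have h3 : ContDiffOn ℝ 3 (uncurry Ψ) univ := by
    have : ((2 : ℕ) : WithTop ℕ∞) + 1 = 3 := by norm_num
    rw [this] at h
    exact h
  exact contDiffOn_univ.1 h3

end Bootstrap

/-- `ψ(t,x) = U(x+t, x−t)` is `C³` if `U` is. -/
theorem contDiff_three_transfer {U : ℝ × ℝ → ℝ} (hU : ContDiff ℝ 3 U) :
    ContDiff ℝ 3 (uncurry fun t x : ℝ => U (x + t, x - t)) := by
  have hm : ContDiff ℝ 3 fun p : ℝ × ℝ => (p.2 + p.1, p.2 - p.1) :=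
    (contDiff_snd.add contDiff_fst).prodMk (contDiff_snd.sub contDiff_fst)
  exact hU.comp hm

/-- **Global even `C³` solutions of `ψ_tt − ψ_xx + Vψ = 0` with compactly supported `C³` data**
(`V ∈ C²` bounded).  Same construction as `exists_even_solution`, with `contDiff_three_psi`. -/
theorem exists_even_solution_C3 {V A : ℝ → ℝ} {CV α β : ℝ} (hV : ContDiff ℝ 2 V)
    (hVb : ∀ x, |V x| ≤ CV) (hA : ContDiff ℝ 3 A) (hA0 : ∀ x, x ∉ Icc α β → A x = 0) :
    ∃ ψ : ℝ → ℝ → ℝ, ContDiff ℝ 3 (uncurry ψ) ∧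
      (∀ t x, iteratedDeriv 2 (fun τ => ψ τ x) t - iteratedDeriv 2 (ψ t) x + V x * ψ t x = 0) ∧
      (∀ x, ψ 0 x = A x) ∧ (∀ x, deriv (fun τ => ψ τ x) 0 = 0) ∧
      (∀ t x, ψ (-t) x = ψ t x) ∧
      (∀ t x, (x < α - |t| ∨ β + |t| < x) → ψ t x = 0) := by
  have hV1 : ContDiff ℝ 1 V := hV.of_le (by norm_num)
  have hA2 : ContDiff ℝ 2 A := hA.of_le (by norm_num)
  -- the coefficient in null coordinates
  set c : ℝ → ℝ → ℝ := fun a b => V ((a + b) / 2) / 4 with hc_def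
  have hc2 : ContDiff ℝ 2 (uncurry c) := by
    show ContDiff ℝ 2 fun p : ℝ × ℝ => V ((p.1 + p.2) / 2) / 4
    exact (hV.comp ((contDiff_fst.add contDiff_snd).div_const 2)).div_const 4
  have hc : ContDiff ℝ 1 (uncurry c) := hc2.of_le (by norm_num)
  have hcc : Continuous (uncurry c) := hc.continuous
  have hcb : ∀ a b, |c a b| ≤ CV / 4 := fun a b => by
    rw [hc_def]; dsimp only; rw [abs_div, abs_of_pos (by norm_num : (0:ℝ) < 4)]
    exact div_le_div_of_nonneg_right (hVb _) (by norm_num)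
  -- bounds on the data
  have hA' : ContDiff ℝ 1 (deriv A) := contDiff_one_deriv_of_two hA2
  have hA'0 : ∀ b, (b < α ∨ β < b) → deriv A b = 0 := fun b hb => deriv_eq_zero_off hA0 hb
  obtain ⟨MA, hMA⟩ := exists_abs_le_of_eq_zero_off hA.continuous hA0
  obtain ⟨MA', hMA'⟩ := exists_abs_le_of_eq_zero_off hA'.continuous (α := α) (β := β)
    (fun x hx => hA'0 x (by
      by_contra h
      exact hx ⟨le_of_not_gt fun h' => h (Or.inl h'), le_of_not_gt fun h' => h (Or.inr h')⟩))
  -- the complement of the characteristic domain of influence of `[α, β]`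
  set Z : Set (ℝ × ℝ) := {p | (p.2 ≤ p.1 ∧ (p.1 < α ∨ β < p.2)) ∨ (p.1 ≤ p.2 ∧ (p.2 < α ∨ β < p.1))}
    with hZ
  have hZA : ∀ p ∈ Z, A p.1 = 0 := by
    rintro ⟨a, b⟩ hp
    apply hA0
    rintro ⟨h1, h2⟩
    rcases hp with ⟨hba, h | h⟩ | ⟨hab, h | h⟩ <;> dsimp only at * <;> linarith
  have hZA' : ∀ p ∈ Z, deriv A p.2 = 0 := by
    rintro ⟨a, b⟩ hp
    apply hA'0
    rcases hp with ⟨hba, h | h⟩ | ⟨hab, h | h⟩ <;> dsimp only at *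
    · left; linarith
    · right; linarith
    · left; linarith
    · right; linarith
  have hZ1 : ∀ p ∈ Z, ∀ s ∈ uIcc p.2 p.1, (p.1, s) ∈ Z := by
    rintro ⟨a, b⟩ hp s hs
    rcases hp with ⟨hba, h | h⟩ | ⟨hab, h | h⟩ <;> dsimp only at *
    · rw [uIcc_of_le hba] at hs; exact Or.inl ⟨hs.2, Or.inl h⟩
    · rw [uIcc_of_le hba] at hs; exact Or.inl ⟨hs.2, Or.inr (lt_of_lt_of_le h hs.1)⟩
    · rw [uIcc_of_ge hab] at hs; exact Or.inr ⟨hs.1, Or.inl (lt_of_le_of_lt hs.2 h)⟩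
    · rw [uIcc_of_ge hab] at hs; exact Or.inr ⟨hs.1, Or.inr h⟩
  have hZ2 : ∀ p ∈ Z, ∀ s ∈ uIcc p.2 p.1, (s, p.2) ∈ Z := by
    rintro ⟨a, b⟩ hp s hs
    rcases hp with ⟨hba, h | h⟩ | ⟨hab, h | h⟩ <;> dsimp only at *
    · rw [uIcc_of_le hba] at hs; exact Or.inl ⟨hs.1, Or.inl (lt_of_le_of_lt hs.2 h)⟩
    · rw [uIcc_of_le hba] at hs; exact Or.inl ⟨hs.1, Or.inr h⟩
    · rw [uIcc_of_ge hab] at hs; exact Or.inr ⟨hs.2, Or.inl h⟩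
    · rw [uIcc_of_ge hab] at hs; exact Or.inr ⟨hs.2, Or.inr (lt_of_lt_of_le h hs.1)⟩
  have hZsw : ∀ p : ℝ × ℝ, p ∈ Z → (p.2, p.1) ∈ Z := by
    rintro ⟨a, b⟩ hp
    rcases hp with ⟨hba, h⟩ | ⟨hab, h⟩
    · exact Or.inr ⟨hba, h⟩
    · exact Or.inl ⟨hab, h⟩
  -- Picard
  obtain ⟨Ψ, Q, hΨc, hQc, hΨ, hQ, hZ0⟩ := exists_picard_fixedPoint (A := A) (A' := deriv A) hcc hcb
    hA.continuous hA'.continuous hMA hMA' Z hZA hZA' hZ1 hZ2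
  -- the bootstrap package
  set U : ℝ × ℝ → ℝ := uncurry Ψ with hU
  set Pf : ℝ × ℝ → ℝ := fun p => deriv A p.1 - Q p.1 p.1 - ∫ s in p.2..p.1, c p.1 s * Ψ p.1 s
    with hPf
  set Qf : ℝ × ℝ → ℝ := uncurry Q with hQf
  set cc : ℝ × ℝ → ℝ := fun p => c p.1 p.2 with hcc_def
  have hU3 : ContDiff ℝ 3 U := contDiff_three_psi hc2 hA hΨc hQc hΨ hQ
  have hU2 : ContDiff ℝ 2 U := hU3.of_le (by norm_num)
  have hP1 : ContDiff ℝ 1 Pf := contDiff_one_P hc hA2 hΨc hQc hΨ hQ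
  have hQ1 : ContDiff ℝ 1 Qf := contDiff_one_Q hc hA2 hΨc hQc hΨ hQ
  have hUd : ∀ p, HasFDerivAt U ((Pf p) • ContinuousLinearMap.fst ℝ ℝ ℝ +
      (Qf p) • ContinuousLinearMap.snd ℝ ℝ ℝ) p := fun p =>
    hasFDerivAt_psi hc hA2 hΨc hQc hΨ hQ p
  have hPb : ∀ p, fderiv ℝ Pf p (0, 1) = cc p * U p := fun p =>
    fderiv_P_snd hc hA2 hΨc hQc hΨ hQ p
  have hQa : ∀ p, fderiv ℝ Qf p (1, 0) = cc p * U p := fun p =>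
    fderiv_Q_fst hc hA2 hΨc hQc hΨ hQ p
  have hcs : ∀ p : ℝ × ℝ, cc (p.2, p.1) = cc p := fun p => by
    simp only [hcc_def, hc_def, add_comm]
  -- symmetrise
  obtain ⟨-, hP1', hQ1', hUd', hPb', hQa'⟩ := symmetrise hU2 hP1 hQ1 hUd hPb hQa hcs
  -- the solution
  set U' : ℝ × ℝ → ℝ := fun p => 2⁻¹ * (U p + U (p.2, p.1)) with hU'
  have hU3' : ContDiff ℝ 3 U' := by
    have hsw : ContDiff ℝ 3 fun p : ℝ × ℝ => (p.2, p.1) := contDiff_snd.prodMk contDiff_fst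
    exact contDiff_const.mul (hU3.add (hU3.comp hsw))
  refine ⟨fun t x => U' (x + t, x - t), contDiff_three_transfer hU3', ?_, ?_, ?_, ?_, ?_⟩
  · -- the equation
    intro t x
    have h := iteratedDeriv_two_time_sub_space (U := U') hP1' hQ1' hUd' hPb' hQa' t x
    have hcx : cc (x + t, x - t) = V x / 4 := by
      simp only [hcc_def, hc_def]
      congr 2; ring
    rw [hcx] at h
    have h' : iteratedDeriv 2 (fun τ => U' (x + τ, x - τ)) t
        - iteratedDeriv 2 (fun y => U' (y + t, y - t)) x = -(V x * U' (x + t, x - t)) := by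
      rw [h]; ring
    show iteratedDeriv 2 (fun τ => U' (x + τ, x - τ)) t
        - iteratedDeriv 2 (fun y => U' (y + t, y - t)) x + V x * U' (x + t, x - t) = 0
    rw [h']; ring
  · -- `ψ(0, ·) = A`
    intro x
    show 2⁻¹ * (U (x + 0, x - 0) + U ((x + 0, x - 0).2, (x + 0, x - 0).1)) = A x
    simp only [add_zero, sub_zero, hU, uncurry_apply_pair, hΨ x x, intervalIntegral.integral_same,
      sub_zero]
    ring
  · -- `ψ_t(0, ·) = 0`
    intro x
    have h := hasDerivAt_transfer_time hUd' (0 : ℝ) x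
    rw [h.deriv]
    simp only [add_zero, sub_zero]
    ring
  · -- evenness
    intro t x
    show 2⁻¹ * (U (x + -t, x - -t) + U ((x + -t, x - -t).2, (x + -t, x - -t).1))
      = 2⁻¹ * (U (x + t, x - t) + U ((x + t, x - t).2, (x + t, x - t).1))
    simp only [← sub_eq_add_neg, sub_neg_eq_add]
    ring
  · -- domain of influence
    intro t x hx
    have hmem : (x + t, x - t) ∈ Z := by
      rcases le_or_gt 0 t with ht | ht
      · rw [abs_of_nonneg ht] at hx
        refine Or.inl ⟨by linarith, ?_⟩
        rcases hx with hx | hx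
        · left; linarith
        · right; linarith
      · rw [abs_of_neg ht] at hx
        refine Or.inr ⟨by linarith, ?_⟩
        rcases hx with hx | hx
        · left; linarith
        · right; linarith
    have h1 : U (x + t, x - t) = 0 := (hZ0 _ hmem).1
    have h2 : U (x - t, x + t) = 0 := (hZ0 _ (hZsw _ hmem)).1
    show 2⁻¹ * (U (x + t, x - t) + U ((x + t, x - t).2, (x + t, x - t).1)) = 0
    simp [h1, h2]

end Summit.FinalStateConjecture.FinalStateConjecture.Theorems.Blindness

end
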